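import Mathlib
import Summits.Ventures.PercRepro.TriangleCapSubBandOne
import Summits.Ventures.PercRepro.TriangleCapSubBand

/-!
# PercRepro — THE DEFICIENCY IDENTITY: THE BAND VALUE THROUGH THE DEGREE DEFICITS OF THE OFF-EDGE GRAPH
(p3, gen 54; part 279)

For a triangle-free `H` with `s` edges, a vertex `w` of degree `s − t ≥ 1`, and a bound `D` on every off-degree
`c(v) = offDeg H w v`, the band value `2 j` (`Σ d² + 2 t (s − t − 1) + 2 j = s (s + 1)`) satisfies

  **`2 j + 2 t (D − 1) = t (t − 1) + 2 |inside| + Σ_{v ≠ w} c(v) (D − c(v))`**   (`deficiency_identity`)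

— the band value is the regular value `C(t,2) − t (D − 1)` plus the DEFICIENCY `|inside| + ½ Σ c(v) (D − c(v))`
(each inside edge costs one, each vertex of off-degree `c < D` costs `c (D − c) / 2`).  Proof: `2 j = t (t − 1) +
2 |inside| − offAdjPairs` (the vertex decomposition with `attach + |inside| = t`) and `Σ_{v ≠ w} c (D − c) +
offAdjPairs + 2 t = 2 t D` termwise (`c (D − c) + c (c − 1) + c = c D` for `c ≤ D`).  Consequences: the REGULAR
BOUND `t (t − 1) ≤ 2 j + 2 t (D − 1)` (`band_ge_regular`) with equality iff there is no inside edge and every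
off-degree is `0` or `D` (`band_eq_regular_iff`); the split over the non-neighbours and the neighbours of `w`
(`deficiency_identity_split`); the off-degree of a neighbour `y` of `w` counts its non-neighbour ends
(`offDeg_nbr_eq_card`), the off-degree of a non-neighbour `x` splits into its neighbours in `N(w)` and its
non-neighbour neighbours (`offDeg_nonNbr_eq_add`).  Axioms: standard.
-/

namespace PercRepro

namespace TriangleCap

namespace C047

open Finset

variable {V : Type*} [Fintype V] [DecidableEq V]

omit [Fintype V] in
/-- No triangle: `a ~ b`, `b ~ c`, `a ~ c` is impossible in a triangle-free graph. -/
theorem no_triangle (H : SimpleGraph V) (hfree : H.CliqueFree 3) {a b c : V} (hab : H.Adj a b) (hbc : H.Adj b c)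
    (hac : H.Adj a c) : False :=
  hfree {a, b, c} (SimpleGraph.is3Clique_triple_iff.mpr ⟨hab, hac, hbc⟩)

/-- The termwise identity `c (D − c) + c (c − 1) + c = c D` for `c ≤ D`. -/
theorem deficiency_term (c D : ℕ) (h : c ≤ D) : c * (D - c) + c * (c - 1) + c = c * D := by
  rcases Nat.eq_zero_or_pos c with rfl | hc
  · simp
  · obtain ⟨d, rfl⟩ : ∃ d, D = c + d := ⟨D - c, by omega⟩
    rw [Nat.add_sub_cancel_left]
    obtain ⟨c', rfl⟩ : ∃ c', c = c' + 1 := ⟨c - 1, by omega⟩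
    rw [Nat.add_sub_cancel]
    ring

/-- `Σ_{v ≠ w} c(v) (D − c(v)) + offAdjPairs + 2 t = 2 t D` when every off-degree is at most `D`. -/
theorem sum_offDeg_deficiency (H : SimpleGraph V) [DecidableRel H.Adj] (w : V) (D : ℕ)
    (hD : ∀ v, offDeg H w v ≤ D) :
    ∑ v ∈ univ.erase w, offDeg H w v * (D - offDeg H w v) + offAdjPairs H w + 2 * (offEdges H w).card =
      2 * ((offEdges H w).card * D) := by
  have h2 : 2 * ((offEdges H w).card * D) = (∑ v ∈ univ.erase w, offDeg H w v) * D := by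
    rw [sum_erase_offDeg]
    ring
  rw [h2, sum_mul, ← sum_erase_offDeg_mul_pred, ← sum_erase_offDeg, ← sum_add_distrib, ← sum_add_distrib]
  apply sum_congr rfl
  intro v _
  exact deficiency_term _ _ (hD v)

/-- **THE DEFICIENCY IDENTITY:** `2 j + 2 t (D − 1) = t (t − 1) + 2 |inside| + Σ_{v ≠ w} c(v) (D − c(v))` for a
triangle-free `H` with `s` edges, `w` of degree `s − t ≥ 1`, every off-degree `≤ D`, at the band value `2 j`. -/
theorem deficiency_identity (H : SimpleGraph V) [DecidableRel H.Adj] (hfree : H.CliqueFree 3) (s t j D : ℕ)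
    (hs : H.edgeFinset.card = s) (w : V) (hw : deg H w + t = s) (hw1 : 1 ≤ deg H w)
    (hj : ∑ v, deg H v * deg H v + 2 * (t * (s - t - 1)) + 2 * j = s * (s + 1))
    (hD : ∀ v, offDeg H w v ≤ D) :
    2 * j + 2 * (t * (D - 1)) =
      t * (t - 1) + 2 * (insideEdges H w).card + ∑ v ∈ univ.erase w, offDeg H w v * (D - offDeg H w v) := by
  have hdec := sum_deg_sq_vertex_decomposition H w
  have hcard := card_offEdges_add_deg H w
  have hatt := attach_add_card_inside H hfree w
  have hdef := sum_offDeg_deficiency H w D hD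
  have ht : (offEdges H w).card = t := by omega
  rw [ht] at hdec hatt hdef
  obtain ⟨d, hd⟩ : ∃ d, deg H w = d := ⟨_, rfl⟩
  rw [hd] at hdec hw hw1
  subst hw
  rw [Nat.add_sub_cancel] at hj
  set Q := ∑ v, deg H v * deg H v with hQ
  set X := ∑ v ∈ univ.erase w, offDeg H w v * (D - offDeg H w v) with hX
  set A := attach H w with hA
  set P := offAdjPairs H w with hP
  set I := (insideEdges H w).card with hI
  rcases Nat.eq_zero_or_pos t with rfl | ht1
  · have hX0 : X = 0 := by omega
    have hP0 : P = 0 := by omega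
    have hI0 : I = 0 := by omega
    rw [hX0, hI0]
    simp only [mul_zero, add_zero, zero_mul, Nat.zero_sub] at hj ⊢
    nlinarith
  · have hD1 : 1 ≤ D := by
      rcases Nat.eq_zero_or_pos D with rfl | h
      · simp at hdef
        omega
      · exact h
    have e1 : d - 1 + 1 = d := by omega
    have e2 : D - 1 + 1 = D := by omega
    have e3 : t - 1 + 1 = t := by omega
    zify [hw1, hD1, ht1] at hj hdec hatt hdef ⊢
    linear_combination hj - hdec - 2 * hatt - hdef

/-- **THE REGULAR BOUND:** `t (t − 1) ≤ 2 j + 2 t (D − 1)` — the band value is at least the value of a `D`-regular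
off-edge graph without inside edges. -/
theorem band_ge_regular (H : SimpleGraph V) [DecidableRel H.Adj] (hfree : H.CliqueFree 3) (s t j D : ℕ)
    (hs : H.edgeFinset.card = s) (w : V) (hw : deg H w + t = s) (hw1 : 1 ≤ deg H w)
    (hj : ∑ v, deg H v * deg H v + 2 * (t * (s - t - 1)) + 2 * j = s * (s + 1))
    (hD : ∀ v, offDeg H w v ≤ D) : t * (t - 1) ≤ 2 * j + 2 * (t * (D - 1)) := by
  have := deficiency_identity H hfree s t j D hs w hw hw1 hj hD
  omega

/-- **THE EQUALITY CASE OF THE REGULAR BOUND:** `2 j + 2 t (D − 1) = t (t − 1)` iff there is no inside edge and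
every off-degree is `0` or `D`. -/
theorem band_eq_regular_iff (H : SimpleGraph V) [DecidableRel H.Adj] (hfree : H.CliqueFree 3) (s t j D : ℕ)
    (hs : H.edgeFinset.card = s) (w : V) (hw : deg H w + t = s) (hw1 : 1 ≤ deg H w)
    (hj : ∑ v, deg H v * deg H v + 2 * (t * (s - t - 1)) + 2 * j = s * (s + 1))
    (hD : ∀ v, offDeg H w v ≤ D) :
    2 * j + 2 * (t * (D - 1)) = t * (t - 1) ↔
      (insideEdges H w).card = 0 ∧ ∀ v, offDeg H w v = 0 ∨ offDeg H w v = D := by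
  have hid := deficiency_identity H hfree s t j D hs w hw hw1 hj hD
  constructor
  · intro h
    have hz : 2 * (insideEdges H w).card + ∑ v ∈ univ.erase w, offDeg H w v * (D - offDeg H w v) = 0 := by
      omega
    have hI : (insideEdges H w).card = 0 := by omega
    have hsum : ∑ v ∈ univ.erase w, offDeg H w v * (D - offDeg H w v) = 0 := by omega
    refine ⟨hI, fun v => ?_⟩
    by_cases hvw : v = w
    · left
      rw [hvw]
      exact offDeg_self H w
    · have hv := (sum_eq_zero_iff.mp hsum) v (mem_erase.mpr ⟨hvw, mem_univ v⟩)
      rcases Nat.eq_zero_or_pos (offDeg H w v) with h0 | hpos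
      · left
        exact h0
      · right
        have := hD v
        rcases Nat.mul_eq_zero.mp hv with h1 | h1 <;> omega
  · rintro ⟨hI, hall⟩
    have hsum : ∑ v ∈ univ.erase w, offDeg H w v * (D - offDeg H w v) = 0 := by
      apply sum_eq_zero
      intro v _
      rcases hall v with h | h <;> rw [h] <;> simp
    omega

/-- `Σ_{v ≠ w} f v = Σ_{x ∈ nonNbrs} f x + Σ_{y ∈ N(w)} f y`. -/
theorem sum_erase_eq_nonNbrs_add_nbrs (H : SimpleGraph V) [DecidableRel H.Adj] (w : V) (f : V → ℕ) :
    ∑ v ∈ univ.erase w, f v = ∑ x ∈ nonNbrs H w, f x + ∑ y ∈ univ.filter (fun y => H.Adj w y), f y := by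
  have h := sum_filter_add_sum_filter_not (univ.erase w) (fun v => ¬ H.Adj w v) f
  rw [← h]
  unfold nonNbrs
  congr 1
  apply sum_congr _ (fun _ _ => rfl)
  ext y
  simp only [mem_filter, mem_erase, mem_univ, true_and, and_true, not_not]
  constructor
  · rintro ⟨-, h⟩
    exact h
  · intro h
    exact ⟨fun hy => H.irrefl (hy ▸ h), h⟩

/-- The off-degree of `v ≠ w` counts the neighbours of `v` other than `w`. -/
theorem offDeg_eq_card_adj_ne (H : SimpleGraph V) [DecidableRel H.Adj] (w v : V) (hvw : v ≠ w) :
    offDeg H w v = (univ.filter (fun z => H.Adj v z ∧ z ≠ w)).card := by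
  have h := deg_eq_boole_add_offDeg H w v hvw
  unfold deg at h
  have hsplit := card_filter_add_card_filter_not (s := univ.filter (fun z => H.Adj v z))
    (fun z => z ≠ w)
  rw [filter_filter, filter_filter] at hsplit
  have h2 : (univ.filter (fun z => H.Adj v z ∧ ¬ z ≠ w)).card = if H.Adj w v then 1 else 0 := by
    by_cases hadj : H.Adj w v
    · rw [if_pos hadj, card_eq_one]
      refine ⟨w, ?_⟩
      ext z
      simp only [mem_filter, mem_univ, true_and, not_not, mem_singleton]
      constructor
      · rintro ⟨-, h⟩
        exact h
      · rintro rfl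
        exact ⟨hadj.symm, rfl⟩
    · rw [if_neg hadj, card_eq_zero, filter_eq_empty_iff]
      intro z _
      simp only [not_not, not_and]
      intro hz hzw
      exact hadj (hzw ▸ hz).symm
  omega

/-- The off-degree of a neighbour `y` of `w` counts the non-neighbours of `w` adjacent to `y` (triangle-free). -/
theorem offDeg_nbr_eq_card (H : SimpleGraph V) [DecidableRel H.Adj] (hfree : H.CliqueFree 3) (w y : V)
    (hy : H.Adj w y) : offDeg H w y = ((nonNbrs H w).filter (fun x => H.Adj y x)).card := by
  rw [offDeg_eq_card_adj_ne H w y (fun h => H.irrefl (h ▸ hy))]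
  congr 1
  ext z
  simp only [mem_filter, mem_univ, true_and, mem_nonNbrs]
  constructor
  · rintro ⟨hz, hzw⟩
    exact ⟨⟨hzw, fun hwz => no_triangle H hfree hy hz hwz⟩, hz⟩
  · rintro ⟨⟨hzw, -⟩, hz⟩
    exact ⟨hz, hzw⟩

/-- The off-degree of a non-neighbour `x` of `w` splits into its neighbours in `N(w)` and its non-neighbour
neighbours. -/
theorem offDeg_nonNbr_eq_add (H : SimpleGraph V) [DecidableRel H.Adj] (w x : V) (hx : x ∈ nonNbrs H w) :
    offDeg H w x = (univ.filter (fun y => H.Adj w y ∧ H.Adj x y)).card +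
      ((nonNbrs H w).filter (fun z => H.Adj x z)).card := by
  rw [mem_nonNbrs] at hx
  rw [offDeg_eq_card_adj_ne H w x hx.1,
    ← card_filter_add_card_filter_not (s := univ.filter (fun z => H.Adj x z ∧ z ≠ w))
      (fun z => H.Adj w z), filter_filter, filter_filter]
  congr 1
  · congr 1
    ext z
    simp only [mem_filter, mem_univ, true_and]
    constructor
    · rintro ⟨⟨hz, -⟩, hwz⟩
      exact ⟨hwz, hz⟩
    · rintro ⟨hwz, hz⟩
      exact ⟨⟨hz, fun h => H.irrefl (h ▸ hwz)⟩, hwz⟩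
  · congr 1
    ext z
    simp only [mem_filter, mem_univ, true_and, mem_nonNbrs]
    constructor
    · rintro ⟨⟨hz, hzw⟩, hwz⟩
      exact ⟨⟨hzw, hwz⟩, hz⟩
    · rintro ⟨⟨hzw, hwz⟩, hz⟩
      exact ⟨⟨hz, hzw⟩, hwz⟩

/-- **THE DEFICIENCY IDENTITY, SPLIT:** the deficiency of the non-neighbours plus that of the neighbours of `w`. -/
theorem deficiency_identity_split (H : SimpleGraph V) [DecidableRel H.Adj] (hfree : H.CliqueFree 3) (s t j D : ℕ)
    (hs : H.edgeFinset.card = s) (w : V) (hw : deg H w + t = s) (hw1 : 1 ≤ deg H w)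
    (hj : ∑ v, deg H v * deg H v + 2 * (t * (s - t - 1)) + 2 * j = s * (s + 1))
    (hD : ∀ v, offDeg H w v ≤ D) :
    2 * j + 2 * (t * (D - 1)) = t * (t - 1) + 2 * (insideEdges H w).card +
      ∑ x ∈ nonNbrs H w, offDeg H w x * (D - offDeg H w x) +
      ∑ y ∈ univ.filter (fun y => H.Adj w y), offDeg H w y * (D - offDeg H w y) := by
  rw [deficiency_identity H hfree s t j D hs w hw hw1 hj hD, sum_erase_eq_nonNbrs_add_nbrs H w]
  ring

end C047

end TriangleCap

end PercRepro
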